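import Summits.FinalStateConjecture.FinalStateConjecture.Statement
import Literature.Geometry.Lorentzian.StationaryFinalStateDecomposition
import Literature.Geometry.Lorentzian.KerrDataProofs
import Literature.Geometry.Lorentzian.KerrSchildCoord
import Literature.Geometry.Lorentzian.LeviCivitaProofs
import HarnessLib

/-!
# Route ZeroEnergyKerrOrBomb · crux `StationaryLimitReduction` — posited objects of the line
# `one-locked-explosion` (route-posited definitions, D-0016 `<Route>Defs` convention)

This file carries no mathematics beyond definitions (and two definitional read-back lemmas). It is
the STABLE part of the vocabulary over which the registered stubs of the line `one-locked-explosion`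
of crux stmt-FinalStateConjecture-10021 (`ZeroEnergyKerrOrBomb.StationaryLimitReduction :=
KerrOrBomb → FinalStateConjecture`) are stated — skeleton
`Cruxes/StationaryLimitReduction/Lines/one-locked-explosion.lean` (planner
planner-cruxplan-stmt-FinalStateConjecture-10021-one-locked-explosion-0; lead
prover-line-stmt-FinalStateConjecture-10021-0) — moved verbatim out of the crux workfile so that stub
proofs can land as `Theorems/…` files (`--supports stmt-FinalStateConjecture-10021`) importing it:

* `HasLocalEscape 𝓓 P d` — an admissible smooth injective curve through `d` whose members are good
  on a punctured parameter neighbourhood of `0` (stubs 1, 2, 3, 7);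
* `SummitProperty X D` — verbatim the lambda of `FinalStateConjecture` (`summit_iff` is `Iff.rfl`);
* `InTelescope 𝓑` — verbatim the five hypotheses of the route's target `KerrOrBomb` on a
  `StationaryAFBlackHole` (vacuum, connected horizon, non-degenerate horizon, globally hyperbolic,
  `T ≠ 0` on the d.o.c.), under the tree's Levi-Civita connection `PseudoRiemannianMetric.hasLeviCivita`;
* `IsKerrExterior 𝓑` — verbatim the fact-free conclusion of `KerrOrBomb` (`Kerr.Facts` inhabited inline
  from the tree theorems);
* `ChartIsAsymptoticallyCartesian A` — an adapted chart whose components tend to `η` at large radius,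
  whose leaves `{x⁰ = τ}` are spacelike, which is an immersion, and whose domain reaches `i⁰`
  (contains `{x⁰ = 0, ‖y‖ ≥ R₁}`);
* `SettlesTo 𝒟 sd` — a `C¹` stationary final-state decomposition carried by the self-determined
  exterior, exhaustive, with telescope limit holes read in horizon-penetrating asymptotically
  Cartesian adapted charts.

The line's SPECULATIVE vocabulary (tensor Killing modes `IsTensorModePair`, `IsSimpleTopRate`,
explosion exits `IsExplosionExit`, …; stubs 4–7) deliberately stays in the crux workfile until the
deep-refuter's junk audit of it is in. Everything here is a definition over EXISTING declarations
(`admissibleVacuumData`, `InitialDataSet.IsSmoothDataFamily`, `VacuumCauchyDevelopment`,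
`FinalStateDecomposition`, `StationaryFinalStateDecomposition`, `StationaryAFBlackHole.AdaptedChart`,
`Summit.FinalStateConjecture.HasCompleteNullInfinity/exteriorOf/HasExhaustiveCharts`); nothing restates
a route item. This module deliberately does NOT import the route file `Theses.ZeroEnergyKerrOrBomb`
(closing modules must stay importable by it).
-/

-- every `Summit.FinalStateConjecture.FinalStateConjecture.…` name repeats the summit = sub-problem segment (D-0017 layout)
set_option linter.dupNamespace false

noncomputable section

open scoped Manifold ContDiff Topology ENNReal
open Set Filter Bundle

namespace Summit.FinalStateConjecture.FinalStateConjecture.Theorems.OneLockedExplosion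

open Literature.Geometry.Lorentzian

section Data

variable {X : Type} [TopologicalSpace X] [ChartedSpace E3 X] [IsManifold (𝓡 3) ∞ X]

/-- **Local escape** of the datum `d` into the property `P` inside the admissible class `𝓓`: an
admissible, jointly smooth, injective one-parameter family through `d` all of whose members with
parameter in a PUNCTURED NEIGHBOURHOOD of `0` satisfy `P` (Christodoulou's curve-genericity asks this
for all parameters `≠ 0`; the local form reparametrises into it, `isChristodoulouGeneric_one_of_local`).
[cite: Christodoulou1999, p. A24] -/
def HasLocalEscape (𝓓 : Set (InitialDataSet (𝓡 3) X)) (P : InitialDataSet (𝓡 3) X → Prop)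
    (d : InitialDataSet (𝓡 3) X) : Prop :=
  ∃ F : EuclideanSpace ℝ (Fin 1) → InitialDataSet (𝓡 3) X,
    InitialDataSet.IsSmoothDataFamily 1 F ∧ F 0 = d ∧ Function.Injective F ∧ (∀ c, F c ∈ 𝓓) ∧
      ∃ ε : ℝ, 0 < ε ∧ ∀ c, c ≠ 0 → ‖c‖ < ε → P (F c)

end Data

section Summit

variable (X : Type) [TopologicalSpace X] [ChartedSpace E3 X] [IsManifold (𝓡 3) ∞ X]
  [T2Space X] [SecondCountableTopology X] [ConnectedSpace X]

/-- The property the summit asserts generically of an admissible datum `D` on `X` — VERBATIM the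
lambda of `FinalStateConjecture` (so that `summit_iff` below is `Iff.rfl`): an MGHD exists, and
every MGHD has complete `𝓘⁺` and an exhaustive sub-extremal `N`-Kerr final-state decomposition of
its self-determined exterior. [cite: DafermosLuk2017, Conjecture 1 and §1.2.1] -/
def SummitProperty (D : InitialDataSet (𝓡 3) X) : Prop :=
  (∃ 𝒟 : VacuumCauchyDevelopment D, 𝒟.IsMaximal) ∧
    ∀ 𝒟 : VacuumCauchyDevelopment D, 𝒟.IsMaximal →
      Summit.FinalStateConjecture.HasCompleteNullInfinity 𝒟.toCauchyDevelopment ∧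
        ∃ (O : Set 𝒟.carrier) (d : FinalStateDecomposition 𝒟.toSpacetime O 2),
          (∀ i, Kerr.IsSubextremal (d.mass i) (d.spin i)) ∧
            O = Summit.FinalStateConjecture.exteriorOf 𝒟.toCauchyDevelopment d.charted ∧
              Summit.FinalStateConjecture.HasExhaustiveCharts d

end Summit

-- buildfix 2026-08-19 (ops-buildfix lane, OPERATOR --maintenance candidate): the former lemma
-- `summit_iff : FinalStateConjecture ↔ ∀ X …, IsChristodoulouGeneric (admissibleVacuumData X) (SummitProperty X) 1 := Iff.rfl`
-- unfolded the PRE-T2 summit statement; since the 2026-08-16 re-type (`IsTameChristodoulouGeneric …`) it is no longer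
-- definitionally (nor provably) true and stopped this Defs module — and its 8 importers — from building. It was referenced by
-- no other module (the Cruxes files declare their own `summit_iff`), so it is retired here (deprecate-and-add: nothing to add).

section Holes

/-- **The telescope of the route's target** on a stationary AF black hole `𝓑` (verbatim the
hypotheses of `ZeroEnergyKerrOrBomb.KerrOrBomb` before mode stability, the Levi-Civita connection
being the one the tree proves to exist, `PseudoRiemannianMetric.hasLeviCivita`): vacuum, connected
future event horizon, non-degenerate horizon (as typed: a global Killing field nowhere zero on `𝓔⁺`,
tangent to it, with `∇_K K = κ K`, `κ ≠ 0`), globally hyperbolic carrier, `T ≠ 0` on the d.o.c.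
[cite: ChruscielCosta2008, §1 and §2.4–2.5] -/
def InTelescope (𝓑 : StationaryAFBlackHole.{0}) : Prop :=
  haveI : 𝓑.metric.HasLeviCivita := 𝓑.metric.toPseudoRiemannianMetric.hasLeviCivita
  𝓑.metric.toPseudoRiemannianMetric.IsRicciFlat ∧ IsConnected 𝓑.horizon ∧
    𝓑.toSpacetime.IsNonDegenerateHorizon 𝓑.Mext ∧
      𝓑.metric.IsGloballyHyperbolic 𝓑.timeOrientation ∧ ∀ p ∈ 𝓑.doc, 𝓑.killing p ≠ 0

/-- **`𝓑` is a (fact-free) sub-extremal Kerr exterior** — VERBATIM the conclusion of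
`ZeroEnergyKerrOrBomb.KerrOrBomb` (rev 4): `∃ |a| < M` and a smooth injective isometric immersion of
the ingoing Kerr–Schild exterior chart `(Kerr.exterior M a, Kerr.smoothMetric M a r₊)` into `𝓑` with
range the d.o.c. (`Kerr.Facts`, needed to spell `Kerr.smoothMetric`, is inhabited by the tree theorems
`Kerr.isConnected_region_holds`, `Kerr.contMDiff_bilin_holds`, `Kerr.contMDiff_timeVector_holds`; it is a
`Prop`, so the choice is irrelevant — cf. `Theorems.SwallowTheDatum.kerrFacts`). [cite: ChruscielCosta2008, Thm. 1.3] -/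
def IsKerrExterior (𝓑 : StationaryAFBlackHole.{0}) : Prop :=
  haveI : Kerr.Facts :=
    ⟨Kerr.isConnected_region_holds, Kerr.contMDiff_bilin_holds, Kerr.contMDiff_timeVector_holds⟩
  ∃ (M a : ℝ), Kerr.IsSubextremal M a ∧ ∃ Ψ : Kerr.exterior M a → 𝓑.carrier,
    Function.Injective Ψ ∧ Set.range Ψ = 𝓑.doc ∧
      PseudoRiemannianMetric.IsIsometricImmersion
        (Kerr.smoothMetric M a (Kerr.rPlus M a)).toPseudoRiemannianMetric
        𝓑.metric.toPseudoRiemannianMetric Ψ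

/-- The `T`-adapted chart `A` of `𝓑` is **asymptotically Cartesian with spacelike leaves**
(Alexakis–Ionescu–Klainerman's `Φ₀`, arXiv:0904.0982 §1.1 GR/AF; the ingoing Kerr–Schild chart of
Kerr is the model): (1) the chart components of `g_𝓑` tend to `η` as the chart radius `→ ∞` (they are
time independent, `T` being Killing); (2) every leaf `{x⁰ = τ}` is spacelike (`g(v, v) > 0` for
non-zero `v` tangent to the leaf), so that the leaves are asymptotically CAUCHY hypersurfaces of the
charted region; (3) the chart is an IMMERSION (`dφ` injective everywhere — an `AdaptedChart` is only a
smooth topological open embedding with `dφ(∂₀) = T`, so without (3) `dφ` may degenerate exactly where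
`T` is tangent to a leaf, e.g. in the ergoregion of a rotating hole, and `φ^* g` would be degenerate
there: finding of the lead's wave 1, stub `stub_kerrLimitsAreGood`); (4) the domain contains the whole
exterior `{x⁰ = 0, ‖y‖ ≥ R₁}` of a cylinder (hence, by time invariance, `ℝ × {‖y‖ ≥ R₁}`), so that
clause (1) is not vacuous on a spatially bounded domain and the chart really reaches `i⁰`.
[cite: AlexakisIonescuKlainerman2009, §1.1] -/
def ChartIsAsymptoticallyCartesian {𝓑 : StationaryAFBlackHole.{0}} (A : 𝓑.AdaptedChart) : Prop :=
  (∀ ε : ℝ, 0 < ε → ∃ R₀ : ℝ, ∀ x : A.domain, R₀ ≤ A.radius x.1 → ‖A.bilin x.1 - Minkowski.bilin‖ ≤ ε) ∧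
    (∀ x : A.domain, ∀ v : E4, v 0 = 0 → v ≠ 0 → 0 < A.bilin x.1 v v) ∧
      (∀ x : A.domain, Function.Injective (mfderiv 𝓘(ℝ, E4) (𝓡 4) A.toFun x)) ∧
        ∃ R₁ : ℝ, ∀ y : E3, R₁ ≤ ‖y‖ → E4.ofTimeSpace 0 y ∈ A.domain

end Holes

section Settling

variable {X : Type} [TopologicalSpace X] [ChartedSpace E3 X] [IsManifold (𝓡 3) ∞ X]
  [ConnectedSpace X] {D : InitialDataSet (𝓡 3) X}

/-- **The development `𝒟` settles exhaustively to the admissible stationary holes of `sd`**: the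
stationary final-state decomposition `sd` (`StationaryFinalStateDecomposition … 1`, i.e. in `C¹` —
admissibility controls only `(2,1)` weighted derivatives of the datum at `i⁰`, which protects
late-time `C¹` and not `C²`: far-field focusing packets, `Theorems/StationaryLimitReduction/Negative/
FarFieldFocusing.lean`) is carried by the self-determined exterior `O = J⁺(ι X) ∩ I⁻(charted)` of
the summit, its charts exhaust `O` (the summit's clause, ruling F2), every limit hole lies in the
telescope of the route's target (`InTelescope`), and the adapted charts are HORIZON-PENETRATING
(they cover `𝓗⁺`) and ASYMPTOTICALLY CARTESIAN WITH SPACELIKE LEAVES (`ChartIsAsymptoticallyCartesian`).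
[cite: DafermosLuk2017, §1.2.1] -/
def SettlesTo (𝒟 : VacuumCauchyDevelopment D) {O : Set 𝒟.carrier}
    (sd : StationaryFinalStateDecomposition 𝒟.toSpacetime O 1) : Prop :=
  O = Summit.FinalStateConjecture.exteriorOf 𝒟.toCauchyDevelopment sd.charted ∧
    sd.HasExhaustiveCharts ∧
      ∀ i, InTelescope (sd.hole i) ∧ (sd.hole i).horizon ⊆ Set.range (sd.adapted i).toFun ∧
        ChartIsAsymptoticallyCartesian (sd.adapted i)

/-- Read-back of `SettlesTo` (definitional): exterior clause, exhaustiveness, and the three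
per-hole clauses. [folklore] -/
theorem settlesTo_iff (𝒟 : VacuumCauchyDevelopment D) {O : Set 𝒟.carrier}
    (sd : StationaryFinalStateDecomposition 𝒟.toSpacetime O 1) :
    SettlesTo 𝒟 sd ↔
      O = Summit.FinalStateConjecture.exteriorOf 𝒟.toCauchyDevelopment sd.charted ∧
        sd.HasExhaustiveCharts ∧
          ∀ i, InTelescope (sd.hole i) ∧ (sd.hole i).horizon ⊆ Set.range (sd.adapted i).toFun ∧
            ChartIsAsymptoticallyCartesian (sd.adapted i) :=
  Iff.rfl

end Settling

end Summit.FinalStateConjecture.FinalStateConjecture.Theorems.OneLockedExplosion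

end
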